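import Literature.AlgebraicGeometry.Frobenioids.DivisorMonoidCategoryTheoreticityProofs
import Literature.AlgebraicGeometry.Frobenioids.IrreducibleMorphismsDivIdentity
import Literature.AlgebraicGeometry.Frobenioids.MonoidRealification
import Literature.AlgebraicGeometry.Frobenioids.UnitWiseFrobeniusHolds

/-!
# Kernel DAG index — layer L1, part z (abc-iut-dag's MACHINE DELTA-DRAFT plan/kernel-draft/DAGL1x.lean @03:00Z, deduplicated against the tree by abc-iut-c312-2 and re-lettered; encoding as in c312-2's generated parts @2026-08-26T03:05Z from HOME/plan/DAG.tsv +
KERNEL-DAG-MODULES.tsv (regenerated 2026-08-26T02:58:29Z): 7 landed/discharged nodes NOT YET in the tree index Summits/ABC/IUTFork/DAG*.lean; spec v1.3 §2 (M))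

THIS FILE PROVES NOTHING NEW AND ASSERTS NOTHING (HOME/plan/KERNEL-DAG-SPEC.md). It gives ONE NAME `N_<kernel_id>` to each DAG node whose
statement has LANDED through the gate, knitting the landed declarations BY NAME: claim nodes `N_<id> : Prop := StatementOf @thm₁ ∧ …` (one
conjunct per landed theorem the DAG row names, universe levels instantiated explicitly per the spec's UNIVERSE RULE, arities read off the farm),
witnessed `N_<id>_holds` iff the DAG row is `discharged(p…)` and `N_<id>_part` otherwise (spec §2(b),(c); c312-2 F1/F2); data nodes
`abbrev N_<id> := @<primary>` with the row's further declarations as `example := @…` lines; FACT-style `def … : Prop` declarations are data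
here (a NAME, never asserted). Decl lists come from the `decls` column of plan/DAG.tsv as resolved against the tree sources (unresolvable
tokens dropped and reported to abc-iut-dag on STATUS). Nothing here says abc is proved or refuted or takes a side on [IUTchIII] Cor 3.12.
typed ≠ discharged; indexed ≠ endorsed.
-/

namespace Summit.ABC.IUTFork.DAG

namespace PartL1z
/-- `StatementOf h` is the statement (a `Prop`) of which the landed `h` is the proof: the index NAMES statements, it never re-types them. -/
abbrev StatementOf {P : Prop} (_h : P) : Prop := P
end PartL1z
open PartL1z

noncomputable section
universe u₁ u₂ u₃ u₄ u₅ u₆ u₇ u₈ u₉ u₁₀ u₁₁ u₁₂ u₁₃ u₁₄ u₁₅ u₁₆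

/-- [node FrdI:Prop1.14(v) · L1/D1 · [FrdI] Prop 1.14 (v), kurims p.41 · p408519 · claim · DAG status discharged(p408519)] decls 3 · cites→ - -/
def N_FrdI_Prop1_14_v : Prop :=
  StatementOf @Literature.AlgebraicGeometry.Frobenioids.PreFrobenioid.exists_square_of_isDivIdentity_isPrimeFrobenius.{u₁, u₂, u₃, u₄, u₅} ∧
  StatementOf @Literature.AlgebraicGeometry.Frobenioids.PreFrobenioid.isDivIdentity_isPrimeFrobenius_of_squares.{u₁, u₂, u₃, u₄, u₅} ∧
  StatementOf @Literature.AlgebraicGeometry.Frobenioids.PreFrobenioid.isDivIdentity_isPrimeFrobenius_iff.{u₁, u₂, u₃, u₄, u₅}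
/-- discharge of `N_FrdI_Prop1_14_v`: the landed theorems it names, BY NAME (spec §2(c)); proves nothing new. -/
theorem N_FrdI_Prop1_14_v_holds : N_FrdI_Prop1_14_v := ⟨@Literature.AlgebraicGeometry.Frobenioids.PreFrobenioid.exists_square_of_isDivIdentity_isPrimeFrobenius, @Literature.AlgebraicGeometry.Frobenioids.PreFrobenioid.isDivIdentity_isPrimeFrobenius_of_squares, @Literature.AlgebraicGeometry.Frobenioids.PreFrobenioid.isDivIdentity_isPrimeFrobenius_iff⟩

/-- [node FrdI:Cor2.6 · L1/D1 · [FrdI] Cor 2.6, kurims p.50 · p414661 · claim · DAG status discharged(p414661)] decls 1 · cites→ - -/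
abbrev N_FrdI_Cor2_6 : Prop := StatementOf @Literature.AlgebraicGeometry.Frobenioids.PreFrobenioid.unitWiseFrobeniusExists.{u₁, u₂, u₃, u₄, u₅}
/-- discharge of `N_FrdI_Cor2_6`: the landed theorems it names, BY NAME (spec §2(c)); proves nothing new. -/
theorem N_FrdI_Cor2_6_holds : N_FrdI_Cor2_6 := @Literature.AlgebraicGeometry.Frobenioids.PreFrobenioid.unitWiseFrobeniusExists

/-- [node FrdI:Prop4.1(i) · L1/D1 · [FrdI] Prop 4.1 (i), kurims p.75 · p409825 · claim · DAG status discharged(p409825)] decls 1 · cites→ FrdI:Def2.4 -/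
abbrev N_FrdI_Prop4_1_i : Prop := StatementOf @Literature.AlgebraicGeometry.Frobenioids.PreFrobenioidData.prop41i_holds.{u₁, u₂, u₃, u₄, u₅}
/-- discharge of `N_FrdI_Prop4_1_i`: the landed theorems it names, BY NAME (spec §2(c)); proves nothing new. -/
theorem N_FrdI_Prop4_1_i_holds : N_FrdI_Prop4_1_i := @Literature.AlgebraicGeometry.Frobenioids.PreFrobenioidData.prop41i_holds

/-- [node FrdI:Prop4.1(iii) · L1/D1 · [FrdI] Prop 4.1 (iii), kurims p.75 · p409825 · claim · DAG status discharged(p409825)] decls 2 · cites→ FrdI:Def2.4 -/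
def N_FrdI_Prop4_1_iii : Prop :=
  StatementOf @Literature.AlgebraicGeometry.Frobenioids.PreFrobenioidData.prop41iii_criterion_holds.{u₁, u₂, u₃, u₄, u₅} ∧
  StatementOf @Literature.AlgebraicGeometry.Frobenioids.PreFrobenioidData.prop41iii_square_holds.{u₁, u₂, u₃, u₄, u₅}
/-- discharge of `N_FrdI_Prop4_1_iii`: the landed theorems it names, BY NAME (spec §2(c)); proves nothing new. -/
theorem N_FrdI_Prop4_1_iii_holds : N_FrdI_Prop4_1_iii := ⟨@Literature.AlgebraicGeometry.Frobenioids.PreFrobenioidData.prop41iii_criterion_holds, @Literature.AlgebraicGeometry.Frobenioids.PreFrobenioidData.prop41iii_square_holds⟩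

/-- [node FrdI:Prop4.1(iv) · L1/D1 · [FrdI] Prop 4.1 (iv), kurims p.75 · p409825 · claim · DAG status discharged(p409825)] decls 1 · cites→ FrdI:Def2.4 -/
abbrev N_FrdI_Prop4_1_iv : Prop := StatementOf @Literature.AlgebraicGeometry.Frobenioids.PreFrobenioidData.prop41iv_holds.{u₁, u₂, u₃, u₄, u₅}
/-- discharge of `N_FrdI_Prop4_1_iv`: the landed theorems it names, BY NAME (spec §2(c)); proves nothing new. -/
theorem N_FrdI_Prop4_1_iv_holds : N_FrdI_Prop4_1_iv := @Literature.AlgebraicGeometry.Frobenioids.PreFrobenioidData.prop41iv_holds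

/-- [node FrdI:Prop4.1(v) · L1/D1 · [FrdI] Prop 4.1 (v), kurims p.75 · p409825 · claim · DAG status discharged(p409825)] decls 1 · cites→ FrdI:Def2.4 -/
abbrev N_FrdI_Prop4_1_v : Prop := StatementOf @Literature.AlgebraicGeometry.Frobenioids.PreFrobenioidData.prop41v_holds.{u₁, u₂, u₃, u₄, u₅}
/-- discharge of `N_FrdI_Prop4_1_v`: the landed theorems it names, BY NAME (spec §2(c)); proves nothing new. -/
theorem N_FrdI_Prop4_1_v_holds : N_FrdI_Prop4_1_v := @Literature.AlgebraicGeometry.Frobenioids.PreFrobenioidData.prop41v_holds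

/-- [node FrdI:§0(M⊗R≥0) · L1/D1 · [FrdI] FrdI Convention §0, p.p.10 · p403951 · claim · DAG status discharged(p403951)] decls 21 · cites→ - -/
def N_FrdI_S0_M_R_0 : Prop :=
  StatementOf @Literature.AlgebraicGeometry.Frobenioids.addMonoidHom_nnrat_apply ∧
  StatementOf @Literature.AlgebraicGeometry.Frobenioids.addMonoidHom_nnreal_apply ∧
  StatementOf @Literature.AlgebraicGeometry.Frobenioids.Realification.of_apply.{u₁} ∧
  StatementOf @Literature.AlgebraicGeometry.Frobenioids.isRMonoprime_rDual_of_isQMonoprime.{u₁} ∧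
  StatementOf @Literature.AlgebraicGeometry.Frobenioids.isRMonoprime_rDual_of_isRMonoprime.{u₁} ∧
  StatementOf @Literature.AlgebraicGeometry.Frobenioids.isRMonoprime_rDual_of_isZMonoprime.{u₁} ∧
  StatementOf @Literature.AlgebraicGeometry.Frobenioids.isRMonoprime_rDual.{u₁} ∧
  StatementOf @Literature.AlgebraicGeometry.Frobenioids.isRMonoprime_realification.{u₁} ∧
  StatementOf @Literature.AlgebraicGeometry.Frobenioids.isRMonoprime_realification_of_isQMonoprime.{u₁} ∧
  StatementOf @Literature.AlgebraicGeometry.Frobenioids.Realification.of_injective.{u₁} ∧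
  StatementOf @Literature.AlgebraicGeometry.Frobenioids.Realification.of_dvd.{u₁} ∧
  StatementOf @Literature.AlgebraicGeometry.Frobenioids.Realification.map_of.{u₁}
/-- discharge of `N_FrdI_S0_M_R_0`: the landed theorems it names, BY NAME (spec §2(c)); proves nothing new. -/
theorem N_FrdI_S0_M_R_0_holds : N_FrdI_S0_M_R_0 := ⟨@Literature.AlgebraicGeometry.Frobenioids.addMonoidHom_nnrat_apply, @Literature.AlgebraicGeometry.Frobenioids.addMonoidHom_nnreal_apply, @Literature.AlgebraicGeometry.Frobenioids.Realification.of_apply, @Literature.AlgebraicGeometry.Frobenioids.isRMonoprime_rDual_of_isQMonoprime, @Literature.AlgebraicGeometry.Frobenioids.isRMonoprime_rDual_of_isRMonoprime, @Literature.AlgebraicGeometry.Frobenioids.isRMonoprime_rDual_of_isZMonoprime, @Literature.AlgebraicGeometry.Frobenioids.isRMonoprime_rDual, @Literature.AlgebraicGeometry.Frobenioids.isRMonoprime_realification, @Literature.AlgebraicGeometry.Frobenioids.isRMonoprime_realification_of_isQMonoprime, @Literature.AlgebraicGeometry.Frobenioids.Realification.of_injective, @Literature.AlgebraicGeometry.Frobenioids.Realification.of_dvd,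 @Literature.AlgebraicGeometry.Frobenioids.Realification.map_of⟩
example := @Literature.AlgebraicGeometry.Frobenioids.nnratSMulHom
example := @Literature.AlgebraicGeometry.Frobenioids.nnratAddHomEquiv
example := @Literature.AlgebraicGeometry.Frobenioids.nnrealAddHomEquiv
example := @Literature.AlgebraicGeometry.Frobenioids.natAddHomEquiv
example := @Literature.AlgebraicGeometry.Frobenioids.RDual.{u₁}
example := @Literature.AlgebraicGeometry.Frobenioids.Realification.{u₁}

end

end Summit.ABC.IUTFork.DAG
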